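import Summits.ABC.StewartYu.EuclideanMahlerBasis
import Summits.ABC.StewartYu.WeightedLatticeBasis
import HarnessLib

/-!
# Geometry of numbers in a finite-index sublattice of `ℤ^m`, weighted `ℓ¹` form (III): a sharper
# short basis via the Euclidean norm

Cell topic `Summits/ABC/StewartYu` (cell abc-stewartyu, seat p1); namespace
`Summit.ABC.StewartYu.PrincipalLattice` (theorems only, no definition, no named fact). Sequel to
`WeightedLatticeBasis.lean` (`exists_basis_prod_weighted_le`: a `ℤ`-basis `b` of a finite-index
`L ≤ ℤ^m` with `∏ⱼ F(bⱼ) ≤ (m!)² · d · ∏ wᵢ`, `F(x) = ∑ wᵢ|xᵢ|`, `d` the index) with the loss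
`(m!)²` replaced by `m^m · √(m!)`:

* `sum_weighted_abs_le_sqrt_mul_norm` — Cauchy–Schwarz `F(x) ≤ √m · G(x)` for the weighted
  Euclidean norm `G(x) = (∑ wᵢ² xᵢ²)^{1/2}`;
* `exists_basis_prod_weighted_le_sharp` — **a `ℤ`-basis with `∏ⱼ F(bⱼ) ≤ m^m · √(m!) · d · ∏ wᵢ`**:
  Minkowski's second theorem (`Dioph.exists_directional_system_prod_mul_volume_le`, PROVED in the
  tree [cite: EvertseGyory2015, Thm 4.3.1 (p. 70)]) for the norm `G` transported to `ℤ^m ≅ L`, whose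
  unit ball contains the cube of side `2/√m` (so `∏ G(v_k) ≤ m^{m/2} · d · ∏ wᵢ`, no Gamma
  function needed), the Euclidean Mahler basis `exists_int_basis_prod_le_sqrt_factorial`
  (`∏ G(y_j) ≤ √(m!) · ∏ G(v_k)`), and `F ≤ √m · G`.

This is the lattice input of WP-M♭ (`PadicLogFormsPrincipalReductionSharp.lean`): with `wᵢ = log qᵢ`
it bounds the heights product of Kummer-free principal generators by `m^m √(m!) · p · ∏ log qᵢ`
(`≤ m^{3m/2} p ∏ log qᵢ`) instead of WP-M's `m^{2m} p ∏ log qᵢ`, which lowers the exponent `κ` of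
the principal-unit route by `1/2` (rung `rad^{5/2+ε}`).

## References

* [EvertseGyory2015] J.-H. Evertse, K. Győry, *Unit Equations in Diophantine Number Theory*,
  Cambridge Stud. Adv. Math. 146, CUP 2015 — Thm 4.3.1 (p. 70) (Minkowski's second theorem).
-/

noncomputable section

namespace Summit.ABC.StewartYu.PrincipalLattice

open MeasureTheory Module Finset
open Literature.NumberTheory.DiophantineGeometry.Dioph

/-! ### Cauchy–Schwarz between the weighted `ℓ¹` and `ℓ²` norms -/

/-- `∑ wᵢ|xᵢ| ≤ √m · ‖(wᵢ xᵢ)ᵢ‖₂` (Cauchy–Schwarz with the all-ones vector). [folklore] -/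
theorem sum_weighted_abs_le_sqrt_mul_norm {m : ℕ} (w x : Fin m → ℝ) (hw : ∀ i, 0 < w i) :
    ∑ i, w i * |x i| ≤
      Real.sqrt m * ‖(EuclideanSpace.equiv (Fin m) ℝ).symm (fun i => w i * x i)‖ := by
  have h := Finset.sum_mul_sq_le_sq_mul_sq Finset.univ (fun _ => (1 : ℝ)) (fun i => w i * |x i|)
  have hnorm : ‖(EuclideanSpace.equiv (Fin m) ℝ).symm (fun i => w i * x i)‖ ^ 2 =
      ∑ i, (w i * x i) ^ 2 := by
    rw [EuclideanSpace.real_norm_sq_eq]; simp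
  have habs : ∀ i, (w i * |x i|) ^ 2 = (w i * x i) ^ 2 := fun i => by
    rw [mul_pow, mul_pow, sq_abs]
  have hsq : (∑ i, w i * |x i|) ^ 2 ≤
      (Real.sqrt m * ‖(EuclideanSpace.equiv (Fin m) ℝ).symm (fun i => w i * x i)‖) ^ 2 := by
    rw [mul_pow, Real.sq_sqrt (Nat.cast_nonneg m), hnorm]
    simpa [habs] using h
  have h0 : 0 ≤ ∑ i, w i * |x i| := Finset.sum_nonneg fun i _ => mul_nonneg (hw i).le (abs_nonneg _)
  exact (pow_le_pow_iff_left₀ h0 (by positivity) two_ne_zero).1 hsq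

/-! ### A sharper short basis of a finite-index sublattice of `ℤ^m` -/

/-- **A `ℤ`-basis of a finite-index sublattice with small weighted norms, sharp form.** For
`L ≤ ℤ^m` (`m ≥ 1`) of finite index `d` and weights `wᵢ > 0`, `L` has a `ℤ`-basis `b` with
`∏ⱼ F(bⱼ) ≤ m^m · √(m!) · d · ∏ᵢ wᵢ`, `F(x) = ∑ᵢ wᵢ|xᵢ|`. Transport the weighted Euclidean norm
`G(x) = ‖(wᵢ xᵢ)ᵢ‖₂` to `ℤ^m ≅ L` through a basis matrix `B` (`|det B| = d`): the unit ball of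
`G ∘ B` is the preimage of the Euclidean unit ball under a linear map of determinant `±d ∏ wᵢ` and
contains the preimage of the cube `{|zᵢ| < 1/√m}`, so its volume is `≥ (2/√m)^m/(d ∏ wᵢ)` and
Minkowski's second theorem (`Dioph.exists_directional_system_prod_mul_volume_le`) gives a
directional system `v` with `∏ G(Bv_k) ≤ m^{m/2} d ∏ wᵢ`; the Euclidean Mahler basis
(`exists_int_basis_prod_le_sqrt_factorial`) gives a basis `y` of `ℤ^m` with
`∏ G(By_j) ≤ √(m!) ∏ G(Bv_k)`; finally `F ≤ √m · G` and `b_j = B y_j`.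
[cite: EvertseGyory2015, Thm 4.3.1 (p. 70)] -/
theorem exists_basis_prod_weighted_le_sharp {m : ℕ} (hm : 0 < m) (L : Submodule ℤ (Fin m → ℤ))
    [Finite ((Fin m → ℤ) ⧸ L)] (w : Fin m → ℝ) (hw : ∀ i, 0 < w i) :
    ∃ b : Module.Basis (Fin m) ℤ L,
      ∏ j, (∑ i, w i * |(((b j : L) : Fin m → ℤ) i : ℝ)|) ≤
        (m : ℝ) ^ m * Real.sqrt (m.factorial) * Nat.card ((Fin m → ℤ) ⧸ L) * ∏ i, w i := by
  classical
  -- full rank and a basis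
  have hrank : Module.finrank ℤ L = m := by
    have h := (Submodule.finiteQuotient_iff L).mp ‹_›
    rw [h, Module.finrank_fin_fun]
  let bN : Module.Basis (Fin m) ℤ L := Module.finBasisOfFinrankEq ℤ L hrank
  -- the matrix of the basis (columns) and its determinant
  set B : Matrix (Fin m) (Fin m) ℤ := Matrix.of fun i k => ((bN k : L) : Fin m → ℤ) i with hB
  have hdet : B.det.natAbs = Nat.card ((Fin m → ℤ) ⧸ L) := by
    have h := Submodule.natAbs_det_basis_change (Pi.basisFun ℤ (Fin m)) L bN
    rw [Module.Basis.det_apply] at h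
    rw [← h]
    congr 2
  have hcard_pos : 0 < Nat.card ((Fin m → ℤ) ⧸ L) := Nat.card_pos
  have hdet0 : B.det ≠ 0 := by
    intro h0; rw [h0, Int.natAbs_zero] at hdet; omega
  set Bℝ : Matrix (Fin m) (Fin m) ℝ := B.map (Int.cast : ℤ → ℝ) with hBℝ
  have hdetℝ : Bℝ.det = (B.det : ℝ) := by rw [hBℝ]; norm_cast
  have hdetℝ0 : Bℝ.det ≠ 0 := by rw [hdetℝ]; exact_mod_cast hdet0
  set T : (Fin m → ℝ) →ₗ[ℝ] (Fin m → ℝ) := Matrix.toLin' Bℝ with hT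
  have hTdet : LinearMap.det T = Bℝ.det := by rw [hT, LinearMap.det_toLin']
  have hTinj : Function.Injective T := by
    rw [hT]
    exact Matrix.mulVec_injective_iff_isUnit.mpr
      ((Matrix.isUnit_iff_isUnit_det _).mpr (isUnit_iff_ne_zero.mpr hdetℝ0))
  -- the weights as a diagonal map, and the Euclidean embedding `Φ = (wᵢ (Tx)ᵢ)ᵢ ∈ ℝ^m_ℓ²`
  have hΩ : 0 < ∏ i, w i := Finset.prod_pos fun i _ => hw i
  set Dg : (Fin m → ℝ) →ₗ[ℝ] (Fin m → ℝ) := Matrix.toLin' (Matrix.diagonal w) with hDg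
  have hDg_apply : ∀ x, Dg x = fun i => w i * x i := by
    intro x; ext i; rw [hDg, Matrix.toLin'_apply, Matrix.mulVec_diagonal]
  have hdetDg : LinearMap.det Dg = ∏ i, w i := by
    rw [hDg, LinearMap.det_toLin', Matrix.det_diagonal]
  have hDginj : Function.Injective Dg := by
    rw [hDg]
    exact Matrix.mulVec_injective_iff_isUnit.mpr
      ((Matrix.isUnit_iff_isUnit_det _).mpr (isUnit_iff_ne_zero.mpr
        (by rw [Matrix.det_diagonal]; exact hΩ.ne')))
  set A : (Fin m → ℝ) →ₗ[ℝ] (Fin m → ℝ) := Dg ∘ₗ T with hA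
  have hdetA : LinearMap.det A = (∏ i, w i) * Bℝ.det := by
    rw [hA, LinearMap.det_comp, hdetDg, hTdet]
  have hdetA0 : LinearMap.det A ≠ 0 := by rw [hdetA]; exact mul_ne_zero hΩ.ne' hdetℝ0
  have hAinj : Function.Injective A := by
    rw [hA, LinearMap.coe_comp]; exact hDginj.comp hTinj
  set eE := (EuclideanSpace.equiv (Fin m) ℝ).symm with heE
  set Φ : (Fin m → ℝ) →ₗ[ℝ] EuclideanSpace ℝ (Fin m) := eE.toLinearEquiv.toLinearMap ∘ₗ A with hΦ
  have Φ_apply : ∀ x, Φ x = eE (A x) := fun x => rfl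
  -- the transported weighted Euclidean norm as a seminorm on `ℝ^m`
  let N : Seminorm ℝ (Fin m → ℝ) := (normSeminorm ℝ (EuclideanSpace ℝ (Fin m))).comp Φ
  have N_apply : ∀ x, N x = ‖Φ x‖ := fun x => rfl
  have hN : ∀ x, N x = 0 → x = 0 := by
    intro x hx
    rw [N_apply, norm_eq_zero, Φ_apply] at hx
    have hAx : A x = 0 := by
      have := congrArg (EuclideanSpace.equiv (Fin m) ℝ) hx
      simpa [heE] using this
    exact hAinj (by rw [hAx, map_zero])
  -- Minkowski's second theorem and the Euclidean Mahler basis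
  obtain ⟨v, hli, hmono, -, hvol⟩ := exists_directional_system_prod_mul_volume_le hm N hN
  obtain ⟨y, hygen, hyne, hyle⟩ := exists_int_basis_prod_le_sqrt_factorial Φ v hli hmono
  -- the unit ball of `N` contains `A⁻¹' {‖z‖_∞ < 1/√m}`
  have hmR : (0 : ℝ) < m := by exact_mod_cast hm
  have hsqm : 0 < Real.sqrt m := Real.sqrt_pos.mpr hmR
  set r : ℝ := 1 / Real.sqrt m with hr
  have hr0 : 0 < r := by positivity
  have hmr : (m : ℝ) * r ^ 2 = 1 := by
    rw [hr, div_pow, one_pow, Real.sq_sqrt hmR.le]; field_simp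
  have hsub : A ⁻¹' Metric.ball (0 : Fin m → ℝ) r ⊆ {x : Fin m → ℝ | N x < 1} := by
    intro x hx
    rw [Set.mem_preimage, mem_ball_zero_iff, pi_norm_lt_iff hr0] at hx
    show ‖Φ x‖ < 1
    have hsq : ‖Φ x‖ ^ 2 < 1 := by
      rw [Φ_apply, EuclideanSpace.real_norm_sq_eq]
      have hcoord : ∀ i, (eE (A x)) i = A x i := fun i => by simp [heE]
      simp only [hcoord]
      haveI : Nonempty (Fin m) := ⟨⟨0, hm⟩⟩
      calc ∑ i, (A x i) ^ 2 < ∑ _i : Fin m, r ^ 2 := by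
            refine Finset.sum_lt_sum_of_nonempty Finset.univ_nonempty fun i _ => ?_
            have hi := hx i
            rw [Real.norm_eq_abs] at hi
            exact sq_lt_sq' (by linarith [(abs_lt.mp hi).1]) (abs_lt.mp hi).2
        _ = (m : ℝ) * r ^ 2 := by simp
        _ = 1 := hmr
    have h1 : ‖Φ x‖ ^ 2 < 1 ^ 2 := by rwa [one_pow]
    exact (pow_lt_pow_iff_left₀ (norm_nonneg _) zero_le_one two_ne_zero).1 h1
  have hvolS : ENNReal.ofReal (|(LinearMap.det A)⁻¹| * (2 * r) ^ m) ≤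
      volume {x : Fin m → ℝ | N x < 1} := by
    calc ENNReal.ofReal (|(LinearMap.det A)⁻¹| * (2 * r) ^ m)
        = volume (A ⁻¹' Metric.ball (0 : Fin m → ℝ) r) := by
          rw [MeasureTheory.Measure.addHaar_preimage_linearMap volume hdetA0,
            Real.volume_pi_ball 0 hr0, Fintype.card_fin, ENNReal.ofReal_mul (abs_nonneg _)]
      _ ≤ volume {x : Fin m → ℝ | N x < 1} := measure_mono hsub
  -- `∏ N(v_k) ≤ |det A| (√m)^m = d ∏ w · m^{m/2}`
  set P : ℝ := ∏ k, N (fun i => (v k i : ℝ)) with hP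
  have hP0 : 0 ≤ P := Finset.prod_nonneg fun k _ => apply_nonneg _ _
  have hD0 : 0 < |LinearMap.det A| := abs_pos.mpr hdetA0
  have hPle : P ≤ |LinearMap.det A| * Real.sqrt m ^ m := by
    have h1 : ENNReal.ofReal P * ENNReal.ofReal (|(LinearMap.det A)⁻¹| * (2 * r) ^ m) ≤ 2 ^ m :=
      (mul_le_mul' le_rfl hvolS).trans hvol
    have h2m : (2 : ENNReal) ^ m = ENNReal.ofReal ((2 : ℝ) ^ m) := by
      rw [ENNReal.ofReal_pow (by norm_num), ENNReal.ofReal_ofNat]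
    rw [h2m, ← ENNReal.ofReal_mul hP0, ENNReal.ofReal_le_ofReal_iff (by positivity), abs_inv] at h1
    -- `h1 : P * (|det A|⁻¹ * (2 r)^m) ≤ 2^m`
    have h2 : P * (2 * r) ^ m ≤ 2 ^ m * |LinearMap.det A| := by
      have := mul_le_mul_of_nonneg_left h1 hD0.le
      calc P * (2 * r) ^ m = |LinearMap.det A| * (P * (|LinearMap.det A|⁻¹ * (2 * r) ^ m)) := by
            field_simp
        _ ≤ |LinearMap.det A| * 2 ^ m := this
        _ = 2 ^ m * |LinearMap.det A| := mul_comm _ _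
    have h2r : (2 * r) ^ m * Real.sqrt m ^ m = 2 ^ m := by
      rw [← mul_pow]; congr 1; rw [hr]; field_simp
    have h3 : P * 2 ^ m ≤ (|LinearMap.det A| * Real.sqrt m ^ m) * 2 ^ m := by
      calc P * 2 ^ m = (P * (2 * r) ^ m) * Real.sqrt m ^ m := by rw [← h2r]; ring
        _ ≤ (2 ^ m * |LinearMap.det A|) * Real.sqrt m ^ m :=
            mul_le_mul_of_nonneg_right h2 (by positivity)
        _ = (|LinearMap.det A| * Real.sqrt m ^ m) * 2 ^ m := by ring
    exact le_of_mul_le_mul_right h3 (by positivity)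
  have hdetAabs : |LinearMap.det A| = (∏ i, w i) * Nat.card ((Fin m → ℤ) ⧸ L) := by
    rw [hdetA, abs_mul, abs_of_pos hΩ, hdetℝ, ← Int.cast_abs, ← hdet, Nat.cast_natAbs]
  -- the basis `y` of `ℤ^m` and the basis `b = B y` of `L`
  let yB : Module.Basis (Fin m) ℤ (Fin m → ℤ) :=
    basisOfTopLeSpanOfCardEqFinrank y hygen.ge (by simp)
  have hyB : ∀ j, yB j = y j := fun j => by
    simp [yB, coe_basisOfTopLeSpanOfCardEqFinrank]
  let b : Module.Basis (Fin m) ℤ L := yB.map bN.equivFun.symm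
  have hb : ∀ j, ((b j : L) : Fin m → ℤ) = B.mulVec (y j) := by
    intro j
    have h1 : (b j : L) = bN.equivFun.symm (y j) := by
      rw [Module.Basis.map_apply, hyB]
    rw [h1, Module.Basis.equivFun_symm_apply, Submodule.coe_sum]
    ext i
    simp [Matrix.mulVec, dotProduct, hB, Finset.sum_apply, mul_comm]
  have hbT : ∀ j i, ((((b j : L) : Fin m → ℤ) i : ℤ) : ℝ) = T (fun k => (y j k : ℝ)) i := by
    intro j i
    rw [hb j, hT, Matrix.toLin'_apply]
    have := RingHom.map_mulVec (Int.castRingHom ℝ) B (y j) i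
    simpa [hBℝ, Function.comp_def] using this
  -- `F(b_j) ≤ √m ‖Φ y_j‖`
  have hFle : ∀ j, ∑ i, w i * |(((b j : L) : Fin m → ℤ) i : ℝ)| ≤
      Real.sqrt m * ‖Φ (fun k => (y j k : ℝ))‖ := by
    intro j
    have h := sum_weighted_abs_le_sqrt_mul_norm w (T (fun k => (y j k : ℝ))) hw
    have hrw : (fun i => w i * T (fun k => (y j k : ℝ)) i) = A (fun k => (y j k : ℝ)) := by
      rw [hA, LinearMap.comp_apply, hDg_apply]
    rw [hrw] at h
    calc ∑ i, w i * |(((b j : L) : Fin m → ℤ) i : ℝ)|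
        = ∑ i, w i * |T (fun k => (y j k : ℝ)) i| := Finset.sum_congr rfl fun i _ => by rw [hbT]
      _ ≤ Real.sqrt m * ‖eE (A (fun k => (y j k : ℝ)))‖ := h
      _ = Real.sqrt m * ‖Φ (fun k => (y j k : ℝ))‖ := by rw [Φ_apply]
  -- assemble
  have hsqmm : Real.sqrt m ^ m * Real.sqrt m ^ m = (m : ℝ) ^ m := by
    rw [← mul_pow, Real.mul_self_sqrt hmR.le]
  refine ⟨b, ?_⟩
  calc ∏ j, (∑ i, w i * |(((b j : L) : Fin m → ℤ) i : ℝ)|)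
      ≤ ∏ j, (Real.sqrt m * ‖Φ (fun k => (y j k : ℝ))‖) :=
        Finset.prod_le_prod (fun j _ => Finset.sum_nonneg fun i _ =>
          mul_nonneg (hw i).le (abs_nonneg _)) fun j _ => hFle j
    _ = Real.sqrt m ^ m * ∏ j, ‖Φ (fun k => (y j k : ℝ))‖ := by
        rw [Finset.prod_mul_distrib, Finset.prod_const, Finset.card_univ, Fintype.card_fin]
    _ ≤ Real.sqrt m ^ m * (Real.sqrt (m.factorial : ℝ) * P) :=
        mul_le_mul_of_nonneg_left hyle (by positivity)
    _ ≤ Real.sqrt m ^ m * (Real.sqrt (m.factorial : ℝ) * (|LinearMap.det A| * Real.sqrt m ^ m)) :=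
        mul_le_mul_of_nonneg_left (mul_le_mul_of_nonneg_left hPle (Real.sqrt_nonneg _))
          (by positivity)
    _ = (Real.sqrt m ^ m * Real.sqrt m ^ m) * Real.sqrt (m.factorial : ℝ) * |LinearMap.det A| := by
        ring
    _ = (m : ℝ) ^ m * Real.sqrt (m.factorial) * Nat.card ((Fin m → ℤ) ⧸ L) * ∏ i, w i := by
        rw [hsqmm, hdetAabs]; ring

end Summit.ABC.StewartYu.PrincipalLattice

end
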